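import Literature.MathematicalPhysics.QuantumFieldTheory.Federbush1986.PureAveragesUNLemma13
import Mathlib.Analysis.Calculus.Deriv.Shift

/-!
# `Federbush1986.PureAveragesUNLemma13Converse` — P. Federbush, *A phase cell approach to Yang–Mills theory. III. Local
# stability, modified renormalization group transformation*, Commun. Math. Phys. **110** (1987) 293–309 [Federbush1987PhaseCellIII],
# §1 **Lemma 1.3** (1.12) «x = 0 ⇔ ΣA_i = 0» p. 295–296, PROVED for the model instance `G = U(N)`, every `N`:
# `UN.lemma13_UN : Lemma13 expUN` (`ρ = 1/1000`) — the converse `⇐` by UNIQUENESS of the critical point of (1.2) in the small ball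

statement-level skeleton of published theorems with citation tags; proofs where landed; nothing here is a claim about the Yang–Mills mass gap

PDF held: `fed1987-cmp110-III` (scan `run/shared/lean/pub/pub-balaban/t4/b2b-balaban-t4-lit2/pdf/fed1987-cmp110-III.pdf`, renders
of p. 295–296 under `run/shared/lean/pub/lit-balaban/lit-balaban-r17/renders/fedIII/` and `…/b2b-balaban-t4-lit2/renders/fed1987III/`),
read as images.

CITATION HEADER (lean-in-tree rule).  lit-balaban cell (HOME `run/shared/lean/pub/lit-balaban/`), SKELETON row **F3.Lem1.3** (reader
r17; statement `…Federbush1986.PureAverages.Lemma13`, p238910, untouched); Phase-2 seat p12 (gen 6), unit `lit-balaban-p12`, kind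
«model-instance / generality upgrade», over `…Federbush1986.PureAveragesUNLemma13` (direction `⇒`: `UN.sum_eq_zero_of_isPureAverage_one`,
`UN.fderiv_FLem_zero_of_small`), `…PureAveragesUNLemma12` (`UN.first_order_condition`) and `…PureAveragesUNLemma11` (the holomorphic
line functions `UN.lineΘ`, `UN.lineM`, `UN.lineD`, their Cauchy bounds, `UN.FLem_line_eq`, `UN.differentiableAt_FLem`); the tree
proves the row for `G = SU(2)` (`…PureAveragesSU2Lemma13`, p32).

THE PRINT (p. 295–296): *"Lemma 1.3. x = 0 ⇔ ΣA_i = 0. (1.12)"*; print's argument uses the structure of the BCH series; the proof here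
is the second-order (convexity) form of print's «differentiating (1.2)»: in the small ball the pure average is the ONLY critical
point of (1.2).

THE PROOF GIVEN HERE.  With `F_B` the Lemma-1.1 correction and `ψ_i(τ) := dF_{A_i}(τx)(x)`: the first-order condition of Lemma 1.2
in the direction `V = x` is `2⟨ΣA_i, x⟩ − 2n|x|² = Σ_i ψ_i(1)`, and `ψ_i(0) = 0` (first-variation formula, file `…UNLemma13`).  §1–§2:
along the complexified line `u ↦ −ux` from `0`, `F_B(ux) = Q(u) := 2⟨D, Θ⟩ + ⟨M, M⟩` (`FLem_smul_eq_Qfun`) with `D, Θ, M` holomorphic;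
shifting the base point (`lineΘ_shift`, `deriv_lineΘ_shift`, …) turns the Lemma-1.1 Cauchy bounds into bounds at every centre and,
applied to `Θ′`, `M′` on a circle, into SECOND-ORDER bounds `|Θ″| ≤ 1632ρ₀|h|²`, `|M″| ≤ 24|h|²` at the fixed scale `ρ₀ ≥ |uh| + |B|`
(`norm_deriv_line_le'`, `norm_deriv_deriv_line_le`); hence `Q′ = Qder`, `Q″ = Qder2` (`hasDerivAt_Qfun`, `hasDerivAt_Qder`) with
`|Q″| ≤ 5328ρ₀²|x|²` (`abs_Qder2_le`).  §3: `ψ(τ) = Q′(τ)` on `[0,1]` (`fderiv_FLem_smul_apply_eq_Qder`), so by the mean value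
inequality `|dF_B(x)(x)| = |Q′(1) − Q′(0)| ≤ 5328ρ₀²|x|² < 0.022|x|²` for `ρ₀ = 1/500` (`abs_fderiv_FLem_self_le`).  §4: if `ΣA_i = 0`
then `2n|x|² = |Σψ_i(1)| ≤ 0.022 n|x|²`, so `x = 0`; the direction `⇒` is `…UNLemma13`.  Constants `1/1000`, `1/500`, `5328` are this
file's.  Deliberately NOT here: uniqueness of the pure average as a GLOBAL statement on `U(N)`, Proposition 5.9 for `U(N)`.
-/

namespace Literature.MathematicalPhysics.QuantumFieldTheory.Federbush1986

open scoped Matrix.Norms.Frobenius ComplexConjugate Matrix Topology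
open NormedSpace Metric Set Filter UNGauss

noncomputable section

namespace UN

variable {N : ℕ}

/-! ## §1 Shifting the base point along the complexified line; Cauchy bounds at any centre and of second order -/

/-- `L` along the line from `X` at parameter `u + t` is `L` along the line from `X − uh` at `t`.
[cite: Federbush1987PhaseCellIII, Lemma 1.3 (1.12) p. 295–296] -/
theorem lineL_shift (X Y h : 𝕄 N) (u t : ℂ) : lineL X Y h (u + t) = lineL (X - u • h) Y h t := by
  simp only [lineL, add_smul, sub_sub]

/-- Shift for `M`. [cite: Federbush1987PhaseCellIII, Lemma 1.3 (1.12) p. 295–296] -/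
theorem lineM_shift (X Y h : 𝕄 N) (u t : ℂ) : lineM X Y h (u + t) = lineM (X - u • h) Y h t := by
  simp only [lineM, lineL_shift, add_smul, sub_sub]

/-- Shift for `Θ`. [cite: Federbush1987PhaseCellIII, Lemma 1.3 (1.12) p. 295–296] -/
theorem lineΘ_shift (X Y h : 𝕄 N) (u t : ℂ) : lineΘ X Y h (u + t) = lineΘ (X - u • h) Y h t := by
  simp only [lineΘ, lineM_shift, add_smul, sub_sub]

/-- Shift for `D`. [cite: Federbush1987PhaseCellIII, Lemma 1.3 (1.12) p. 295–296] -/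
theorem lineD_shift (X Y h : 𝕄 N) (u t : ℂ) : lineD X Y h (u + t) = lineD (X - u • h) Y h t := by
  simp only [lineD, add_smul, sub_sub]

/-- `Θ′` at `u` is `Θ′` at `0` for the shifted base. [cite: Federbush1987PhaseCellIII, Lemma 1.3 (1.12) p. 295–296] -/
theorem deriv_lineΘ_shift (X Y h : 𝕄 N) (u : ℂ) : deriv (lineΘ X Y h) u = deriv (lineΘ (X - u • h) Y h) 0 := by
  have e : lineΘ (X - u • h) Y h = fun t => lineΘ X Y h (u + t) := funext fun t => (lineΘ_shift X Y h u t).symm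
  calc deriv (lineΘ X Y h) u = deriv (lineΘ X Y h) (u + 0) := by rw [add_zero]
    _ = deriv (fun t => lineΘ X Y h (u + t)) 0 := (deriv_comp_const_add (lineΘ X Y h) u 0).symm
    _ = deriv (lineΘ (X - u • h) Y h) 0 := by rw [e]

/-- `M′` at `u` is `M′` at `0` for the shifted base. [cite: Federbush1987PhaseCellIII, Lemma 1.3 (1.12) p. 295–296] -/
theorem deriv_lineM_shift (X Y h : 𝕄 N) (u : ℂ) : deriv (lineM X Y h) u = deriv (lineM (X - u • h) Y h) 0 := by
  have e : lineM (X - u • h) Y h = fun t => lineM X Y h (u + t) := funext fun t => (lineM_shift X Y h u t).symm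
  calc deriv (lineM X Y h) u = deriv (lineM X Y h) (u + 0) := by rw [add_zero]
    _ = deriv (fun t => lineM X Y h (u + t)) 0 := (deriv_comp_const_add (lineM X Y h) u 0).symm
    _ = deriv (lineM (X - u • h) Y h) 0 := by rw [e]

/-- The whole derivative FUNCTION shifts. [cite: Federbush1987PhaseCellIII, Lemma 1.3 (1.12) p. 295–296] -/
theorem deriv_lineΘ_shift_fun (X Y h : 𝕄 N) (u : ℂ) :
    deriv (lineΘ (X - u • h) Y h) = fun t => deriv (lineΘ X Y h) (u + t) := by
  have e : lineΘ (X - u • h) Y h = fun t => lineΘ X Y h (u + t) := funext fun t => (lineΘ_shift X Y h u t).symm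
  funext t
  calc deriv (lineΘ (X - u • h) Y h) t = deriv (fun t => lineΘ X Y h (u + t)) t := by rw [e]
    _ = deriv (lineΘ X Y h) (u + t) := deriv_comp_const_add (lineΘ X Y h) u t

/-- Same for `M`. [cite: Federbush1987PhaseCellIII, Lemma 1.3 (1.12) p. 295–296] -/
theorem deriv_lineM_shift_fun (X Y h : 𝕄 N) (u : ℂ) :
    deriv (lineM (X - u • h) Y h) = fun t => deriv (lineM X Y h) (u + t) := by
  have e : lineM (X - u • h) Y h = fun t => lineM X Y h (u + t) := funext fun t => (lineM_shift X Y h u t).symm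
  funext t
  calc deriv (lineM (X - u • h) Y h) t = deriv (fun t => lineM X Y h (u + t)) t := by rw [e]
    _ = deriv (lineM X Y h) (u + t) := deriv_comp_const_add (lineM X Y h) u t

/-- `Θ″` at `u` is `Θ″` at `0` for the shifted base. [cite: Federbush1987PhaseCellIII, Lemma 1.3 (1.12) p. 295–296] -/
theorem deriv_deriv_lineΘ_shift (X Y h : 𝕄 N) (u : ℂ) :
    deriv (deriv (lineΘ X Y h)) u = deriv (deriv (lineΘ (X - u • h) Y h)) 0 := by
  rw [deriv_lineΘ_shift_fun]
  calc deriv (deriv (lineΘ X Y h)) u = deriv (deriv (lineΘ X Y h)) (u + 0) := by rw [add_zero]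
    _ = deriv (fun t => deriv (lineΘ X Y h) (u + t)) 0 := (deriv_comp_const_add (deriv (lineΘ X Y h)) u 0).symm

/-- `M″` at `u` is `M″` at `0` for the shifted base. [cite: Federbush1987PhaseCellIII, Lemma 1.3 (1.12) p. 295–296] -/
theorem deriv_deriv_lineM_shift (X Y h : 𝕄 N) (u : ℂ) :
    deriv (deriv (lineM X Y h)) u = deriv (deriv (lineM (X - u • h) Y h)) 0 := by
  rw [deriv_lineM_shift_fun]
  calc deriv (deriv (lineM X Y h)) u = deriv (deriv (lineM X Y h)) (u + 0) := by rw [add_zero]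
    _ = deriv (fun t => deriv (lineM X Y h) (u + t)) 0 := (deriv_comp_const_add (deriv (lineM X Y h)) u 0).symm

/-- **Cauchy bounds at a fixed scale** `ρ₀ ≥ |X| + |Y|`, `0 < ρ₀ ≤ 1/100`, `h ≠ 0` (circle of radius `ρ₀/|h|`):
`|Θ′(0)| ≤ 408 ρ₀²|h|`, `|M′(0)| ≤ 12 ρ₀|h|`. [cite: Federbush1987PhaseCellIII, Lemma 1.3 (1.12) p. 295–296] -/
theorem norm_deriv_line_le' {X Y h : 𝕄 N} {ρ₀ : ℝ} (hs : ‖X‖ + ‖Y‖ ≤ ρ₀) (hρ0 : 0 < ρ₀) (hρ : ρ₀ ≤ 1 / 100)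
    (hh : h ≠ 0) :
    ‖deriv (lineΘ X Y h) 0‖ ≤ 408 * ρ₀ ^ 2 * ‖h‖ ∧ ‖deriv (lineM X Y h) 0‖ ≤ 12 * ρ₀ * ‖h‖ := by
  have hh0 : 0 < ‖h‖ := norm_pos_iff.mpr hh
  set r := ρ₀ / ‖h‖ with hrdef
  have hr : 0 < r := div_pos hρ0 hh0
  have hrh : r * ‖h‖ = ρ₀ := div_mul_cancel₀ ρ₀ hh0.ne'
  have hXY : 0 ≤ ‖X‖ + ‖Y‖ := by positivity
  have hball : ∀ t ∈ closedBall (0 : ℂ) r, ‖X‖ + ‖Y‖ + ‖t‖ * ‖h‖ ≤ 2 * ρ₀ := by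
    intro t ht
    rw [mem_closedBall, dist_zero_right] at ht
    have : ‖t‖ * ‖h‖ ≤ r * ‖h‖ := mul_le_mul_of_nonneg_right ht hh0.le
    linarith
  have hU : ∀ t ∈ ball (0 : ℂ) (2 * r), ‖X - t • h‖ + ‖Y‖ ≤ 1 / 5 := by
    intro t ht
    rw [mem_ball, dist_zero_right] at ht
    have h1 := norm_line_le X Y h t
    have : ‖t‖ * ‖h‖ ≤ 2 * r * ‖h‖ := mul_le_mul_of_nonneg_right ht.le hh0.le
    nlinarith
  have hsub : closedBall (0 : ℂ) r ⊆ ball (0 : ℂ) (2 * r) := closedBall_subset_ball (by linarith)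
  have hΘd : DiffContOnCl ℂ (lineΘ X Y h) (ball 0 r) :=
    DifferentiableOn.diffContOnCl_ball (U := ball 0 (2 * r))
      (fun t ht => (differentiableAt_lineΘ (hU t ht)).differentiableWithinAt) hsub
  have hMd : DiffContOnCl ℂ (lineM X Y h) (ball 0 r) :=
    DifferentiableOn.diffContOnCl_ball (U := ball 0 (2 * r))
      (fun t ht => (differentiableAt_lineM (hU t ht)).differentiableWithinAt) hsub
  constructor
  · have hC : ∀ t ∈ sphere (0 : ℂ) r, ‖lineΘ X Y h t‖ ≤ 408 * ρ₀ ^ 3 := by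
      intro t ht
      have hb := hball t (sphere_subset_closedBall ht)
      have h1 := norm_lineΘ_le (X := X) (Y := Y) (h := h) (t := t) (by linarith)
      have h2 : (‖X‖ + ‖Y‖ + ‖t‖ * ‖h‖) ^ 3 ≤ (2 * ρ₀) ^ 3 := by gcongr
      nlinarith
    have hc := Complex.norm_deriv_le_of_forall_mem_sphere_norm_le hr hΘd hC
    calc ‖deriv (lineΘ X Y h) 0‖ ≤ 408 * ρ₀ ^ 3 / r := hc
      _ = 408 * ρ₀ ^ 2 * ‖h‖ := by rw [hrdef]; field_simp
  · have hC : ∀ t ∈ sphere (0 : ℂ) r, ‖lineM X Y h t‖ ≤ 12 * ρ₀ ^ 2 := by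
      intro t ht
      have hb := hball t (sphere_subset_closedBall ht)
      have h1 := norm_lineM_le (X := X) (Y := Y) (h := h) (t := t) (by linarith)
      have h2 : (‖X‖ + ‖Y‖ + ‖t‖ * ‖h‖) ^ 2 ≤ (2 * ρ₀) ^ 2 := by gcongr
      nlinarith
    have hc := Complex.norm_deriv_le_of_forall_mem_sphere_norm_le hr hMd hC
    calc ‖deriv (lineM X Y h) 0‖ ≤ 12 * ρ₀ ^ 2 / r := hc
      _ = 12 * ρ₀ * ‖h‖ := by rw [hrdef]; field_simp

/-- The Cauchy bounds at any centre `u` with `|X − uh| + |Y| ≤ ρ₀`. [cite: Federbush1987PhaseCellIII, Lemma 1.3 (1.12) p. 295–296] -/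
theorem norm_deriv_line_le_at {X Y h : 𝕄 N} {ρ₀ : ℝ} (u : ℂ) (hs : ‖X - u • h‖ + ‖Y‖ ≤ ρ₀) (hρ0 : 0 < ρ₀)
    (hρ : ρ₀ ≤ 1 / 100) (hh : h ≠ 0) :
    ‖deriv (lineΘ X Y h) u‖ ≤ 408 * ρ₀ ^ 2 * ‖h‖ ∧ ‖deriv (lineM X Y h) u‖ ≤ 12 * ρ₀ * ‖h‖ := by
  rw [deriv_lineΘ_shift, deriv_lineM_shift]
  exact norm_deriv_line_le' hs hρ0 hρ hh

/-- **Second-order Cauchy bounds** at scale `ρ₀ ≥ |X| + |Y|`, `0 < ρ₀ ≤ 1/200`: `|Θ″(0)| ≤ 1632 ρ₀|h|²`, `|M″(0)| ≤ 24|h|²`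
(Cauchy's estimate for `Θ′`, `M′` on the circle of radius `ρ₀/|h|`, where the first-order bounds hold at scale `2ρ₀`).
[cite: Federbush1987PhaseCellIII, Lemma 1.3 (1.12) p. 295–296] -/
theorem norm_deriv_deriv_line_le {X Y h : 𝕄 N} {ρ₀ : ℝ} (hs : ‖X‖ + ‖Y‖ ≤ ρ₀) (hρ0 : 0 < ρ₀) (hρ : ρ₀ ≤ 1 / 200)
    (hh : h ≠ 0) :
    ‖deriv (deriv (lineΘ X Y h)) 0‖ ≤ 1632 * ρ₀ * ‖h‖ ^ 2 ∧ ‖deriv (deriv (lineM X Y h)) 0‖ ≤ 24 * ‖h‖ ^ 2 := by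
  have hh0 : 0 < ‖h‖ := norm_pos_iff.mpr hh
  set r := ρ₀ / ‖h‖ with hrdef
  have hr : 0 < r := div_pos hρ0 hh0
  have hrh : r * ‖h‖ = ρ₀ := div_mul_cancel₀ ρ₀ hh0.ne'
  have hXY : 0 ≤ ‖X‖ + ‖Y‖ := by positivity
  -- holomorphy of `Θ`, `M` on the disc of radius `3r`, hence of `Θ′`, `M′`
  have hU : ∀ t ∈ ball (0 : ℂ) (3 * r), ‖X - t • h‖ + ‖Y‖ ≤ 1 / 5 := by
    intro t ht
    rw [mem_ball, dist_zero_right] at ht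
    have h1 := norm_line_le X Y h t
    have : ‖t‖ * ‖h‖ ≤ 3 * r * ‖h‖ := mul_le_mul_of_nonneg_right ht.le hh0.le
    nlinarith
  have hΘd : DifferentiableOn ℂ (lineΘ X Y h) (ball 0 (3 * r)) :=
    fun t ht => (differentiableAt_lineΘ (hU t ht)).differentiableWithinAt
  have hMd : DifferentiableOn ℂ (lineM X Y h) (ball 0 (3 * r)) :=
    fun t ht => (differentiableAt_lineM (hU t ht)).differentiableWithinAt
  have hΘd' : DifferentiableOn ℂ (deriv (lineΘ X Y h)) (ball 0 (3 * r)) := fun t ht =>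
    (hΘd.analyticAt (isOpen_ball.mem_nhds ht)).deriv.differentiableAt.differentiableWithinAt
  have hMd' : DifferentiableOn ℂ (deriv (lineM X Y h)) (ball 0 (3 * r)) := fun t ht =>
    (hMd.analyticAt (isOpen_ball.mem_nhds ht)).deriv.differentiableAt.differentiableWithinAt
  have hsub : closedBall (0 : ℂ) r ⊆ ball (0 : ℂ) (3 * r) := closedBall_subset_ball (by linarith)
  have hΘc : DiffContOnCl ℂ (deriv (lineΘ X Y h)) (ball 0 r) := hΘd'.diffContOnCl_ball hsub
  have hMc : DiffContOnCl ℂ (deriv (lineM X Y h)) (ball 0 r) := hMd'.diffContOnCl_ball hsub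
  -- first-order bounds on the circle, at scale `2ρ₀`
  have hsph : ∀ t ∈ sphere (0 : ℂ) r, ‖X - t • h‖ + ‖Y‖ ≤ 2 * ρ₀ := by
    intro t ht
    have ht' : ‖t‖ = r := by simpa using ht
    have h1 := norm_line_le X Y h t
    rw [ht', hrh] at h1
    linarith
  have h2ρ0 : 0 < 2 * ρ₀ := by linarith
  have h2ρ : 2 * ρ₀ ≤ 1 / 100 := by linarith
  constructor
  · have hC : ∀ t ∈ sphere (0 : ℂ) r, ‖deriv (lineΘ X Y h) t‖ ≤ 1632 * ρ₀ ^ 2 * ‖h‖ := by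
      intro t ht
      have := (norm_deriv_line_le_at t (hsph t ht) h2ρ0 h2ρ hh).1
      nlinarith
    have hc := Complex.norm_deriv_le_of_forall_mem_sphere_norm_le hr hΘc hC
    calc ‖deriv (deriv (lineΘ X Y h)) 0‖ ≤ 1632 * ρ₀ ^ 2 * ‖h‖ / r := hc
      _ = 1632 * ρ₀ * ‖h‖ ^ 2 := by rw [hrdef]; field_simp
  · have hC : ∀ t ∈ sphere (0 : ℂ) r, ‖deriv (lineM X Y h) t‖ ≤ 24 * ρ₀ * ‖h‖ := by
      intro t ht
      have := (norm_deriv_line_le_at t (hsph t ht) h2ρ0 h2ρ hh).2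
      nlinarith
    have hc := Complex.norm_deriv_le_of_forall_mem_sphere_norm_le hr hMc hC
    calc ‖deriv (deriv (lineM X Y h)) 0‖ ≤ 24 * ρ₀ * ‖h‖ / r := hc
      _ = 24 * ‖h‖ ^ 2 := by rw [hrdef]; field_simp

/-- Second-order bounds at any centre `u` with `|X − uh| + |Y| ≤ ρ₀`. [cite: Federbush1987PhaseCellIII, Lemma 1.3 (1.12) p. 295–296] -/
theorem norm_deriv_deriv_line_le_at {X Y h : 𝕄 N} {ρ₀ : ℝ} (u : ℂ) (hs : ‖X - u • h‖ + ‖Y‖ ≤ ρ₀) (hρ0 : 0 < ρ₀)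
    (hρ : ρ₀ ≤ 1 / 200) (hh : h ≠ 0) :
    ‖deriv (deriv (lineΘ X Y h)) u‖ ≤ 1632 * ρ₀ * ‖h‖ ^ 2 ∧ ‖deriv (deriv (lineM X Y h)) u‖ ≤ 24 * ‖h‖ ^ 2 := by
  rw [deriv_deriv_lineΘ_shift, deriv_deriv_lineM_shift]
  exact norm_deriv_deriv_line_le hs hρ0 hρ hh

/-- Differentiability of `Θ′` (real parameter) where `Θ` is holomorphic around. [cite: Federbush1987PhaseCellIII, Lemma 1.3 (1.12) p. 295–296] -/
theorem hasDerivAt_deriv_lineΘ_real {X Y h : 𝕄 N} {u : ℝ} (hu : ‖X - (u : ℂ) • h‖ + ‖Y‖ < 1 / 5) :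
    HasDerivAt (fun v : ℝ => deriv (lineΘ X Y h) v) (deriv (deriv (lineΘ X Y h)) u) u := by
  have hcont : Continuous fun t : ℂ => ‖X - t • h‖ + ‖Y‖ := by fun_prop
  have hopen : IsOpen {t : ℂ | ‖X - t • h‖ + ‖Y‖ < 1 / 5} := isOpen_lt hcont continuous_const
  have hd : DifferentiableOn ℂ (lineΘ X Y h) {t : ℂ | ‖X - t • h‖ + ‖Y‖ < 1 / 5} :=
    fun t ht => (differentiableAt_lineΘ (le_of_lt ht)).differentiableWithinAt
  have ha := (hd.analyticAt (hopen.mem_nhds hu)).deriv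
  exact hasDerivAt_ofReal_comp ha.differentiableAt.hasDerivAt

/-- Same for `M′`. [cite: Federbush1987PhaseCellIII, Lemma 1.3 (1.12) p. 295–296] -/
theorem hasDerivAt_deriv_lineM_real {X Y h : 𝕄 N} {u : ℝ} (hu : ‖X - (u : ℂ) • h‖ + ‖Y‖ < 1 / 5) :
    HasDerivAt (fun v : ℝ => deriv (lineM X Y h) v) (deriv (deriv (lineM X Y h)) u) u := by
  have hcont : Continuous fun t : ℂ => ‖X - t • h‖ + ‖Y‖ := by fun_prop
  have hopen : IsOpen {t : ℂ | ‖X - t • h‖ + ‖Y‖ < 1 / 5} := isOpen_lt hcont continuous_const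
  have hd : DifferentiableOn ℂ (lineM X Y h) {t : ℂ | ‖X - t • h‖ + ‖Y‖ < 1 / 5} :=
    fun t ht => (differentiableAt_lineM (le_of_lt ht)).differentiableWithinAt
  have ha := (hd.analyticAt (hopen.mem_nhds hu)).deriv
  exact hasDerivAt_ofReal_comp ha.differentiableAt.hasDerivAt

/-! ## §2 `Q(u) = F_B(ux)` in closed form (base `0`, direction `h = x`), `Q′`, `Q″` and the bound `|Q″| ≤ 5328 ρ₀²|h|²` -/

/-- `Q(u) := 2⟨D(u), Θ(u)⟩ + ⟨M(u), M(u)⟩` along the line `u ↦ −uh` from `X = 0`, with `Y = b`; for `b = B`, `h = x` in `𝔲(N)` this is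
`F_B(ux)` (`FLem_smul_eq_Qfun`). [cite: Federbush1987PhaseCellIII, Lemma 1.3 (1.12) p. 295–296] -/
def Qfun (b h : 𝕄 N) (u : ℝ) : ℝ :=
  2 * frobB (lineD 0 b h u) (lineΘ 0 b h u) + frobB (lineM 0 b h u) (lineM 0 b h u)

/-- `Q′(u) = 2(⟨D, Θ′⟩ + ⟨−h, Θ⟩) + (⟨M, M′⟩ + ⟨M′, M⟩)`. [cite: Federbush1987PhaseCellIII, Lemma 1.3 (1.12) p. 295–296] -/
def Qder (b h : 𝕄 N) (u : ℝ) : ℝ :=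
  2 * (frobB (lineD 0 b h u) (deriv (lineΘ 0 b h) u) + frobB (-h) (lineΘ 0 b h u))
    + (frobB (lineM 0 b h u) (deriv (lineM 0 b h) u) + frobB (deriv (lineM 0 b h) u) (lineM 0 b h u))

/-- `Q″(u) = 2(⟨D, Θ″⟩ + 2⟨−h, Θ′⟩) + (⟨M, M″⟩ + 2⟨M′, M′⟩ + ⟨M″, M⟩)` (as the product rule delivers it).
[cite: Federbush1987PhaseCellIII, Lemma 1.3 (1.12) p. 295–296] -/
def Qder2 (b h : 𝕄 N) (u : ℝ) : ℝ :=
  2 * ((frobB (lineD 0 b h u) (deriv (deriv (lineΘ 0 b h)) u) + frobB (-h) (deriv (lineΘ 0 b h) u))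
        + frobB (-h) (deriv (lineΘ 0 b h) u))
    + ((frobB (lineM 0 b h u) (deriv (deriv (lineM 0 b h)) u) + frobB (deriv (lineM 0 b h) u) (deriv (lineM 0 b h) u))
        + (frobB (deriv (lineM 0 b h) u) (deriv (lineM 0 b h) u) + frobB (deriv (deriv (lineM 0 b h)) u) (lineM 0 b h u)))

/-- `Q′` is the derivative of `Q` (`|uh| + |b| ≤ 1/5`). [cite: Federbush1987PhaseCellIII, Lemma 1.3 (1.12) p. 295–296] -/
theorem hasDerivAt_Qfun {b h : 𝕄 N} {u : ℝ} (hu : ‖(0 : 𝕄 N) - (u : ℂ) • h‖ + ‖b‖ ≤ 1 / 5) :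
    HasDerivAt (Qfun b h) (Qder b h u) u := by
  have hΘ := hasDerivAt_ofReal_comp (differentiableAt_lineΘ hu).hasDerivAt
  have hM := hasDerivAt_ofReal_comp (differentiableAt_lineM hu).hasDerivAt
  have hD := hasDerivAt_lineD_real 0 b h u
  have hb := isBoundedBilinearMap_frobB (N := N)
  have h1 := (hb.hasFDerivAt (lineD 0 b h u, lineΘ 0 b h u)).comp_hasDerivAt_of_eq u (hD.prodMk hΘ) rfl
  have h2 := (hb.hasFDerivAt (lineM 0 b h u, lineM 0 b h u)).comp_hasDerivAt_of_eq u (hM.prodMk hM) rfl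
  simp only [Function.comp_def, IsBoundedBilinearMap.deriv_apply] at h1 h2
  exact (h1.const_mul 2).add h2

/-- `Q″` is the derivative of `Q′` (`|uh| + |b| < 1/5`). [cite: Federbush1987PhaseCellIII, Lemma 1.3 (1.12) p. 295–296] -/
theorem hasDerivAt_Qder {b h : 𝕄 N} {u : ℝ} (hu : ‖(0 : 𝕄 N) - (u : ℂ) • h‖ + ‖b‖ < 1 / 5) :
    HasDerivAt (Qder b h) (Qder2 b h u) u := by
  have hΘ := hasDerivAt_ofReal_comp (differentiableAt_lineΘ hu.le).hasDerivAt
  have hM := hasDerivAt_ofReal_comp (differentiableAt_lineM hu.le).hasDerivAt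
  have hΘ' := hasDerivAt_deriv_lineΘ_real hu
  have hM' := hasDerivAt_deriv_lineM_real hu
  have hD := hasDerivAt_lineD_real 0 b h u
  have hb := isBoundedBilinearMap_frobB (N := N)
  have hA := (hb.hasFDerivAt (lineD 0 b h u, deriv (lineΘ 0 b h) u)).comp_hasDerivAt_of_eq u (hD.prodMk hΘ') rfl
  have hBt := ((frobB (-h)).hasFDerivAt).comp_hasDerivAt u hΘ
  have hC := (hb.hasFDerivAt (lineM 0 b h u, deriv (lineM 0 b h) u)).comp_hasDerivAt_of_eq u (hM.prodMk hM') rfl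
  have hD' := (hb.hasFDerivAt (deriv (lineM 0 b h) u, lineM 0 b h u)).comp_hasDerivAt_of_eq u (hM'.prodMk hM) rfl
  simp only [Function.comp_def, IsBoundedBilinearMap.deriv_apply] at hA hBt hC hD'
  exact ((hA.add hBt).const_mul 2).add (hC.add hD')

/-- **`|Q″(u)| ≤ 5328 ρ₀²|h|²`** whenever `|uh| + |b| ≤ ρ₀`, `0 < ρ₀ ≤ 1/200`, `h ≠ 0` — from `|D| ≤ ρ₀`, `|M| ≤ 3ρ₀²`,
`|Θ′| ≤ 408ρ₀²|h|`, `|M′| ≤ 12ρ₀|h|`, `|Θ″| ≤ 1632ρ₀|h|²`, `|M″| ≤ 24|h|²`. [cite: Federbush1987PhaseCellIII, Lemma 1.3 (1.12) p. 295–296] -/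
theorem abs_Qder2_le {b h : 𝕄 N} {ρ₀ : ℝ} {u : ℝ} (hs : ‖(0 : 𝕄 N) - (u : ℂ) • h‖ + ‖b‖ ≤ ρ₀) (hρ0 : 0 < ρ₀)
    (hρ : ρ₀ ≤ 1 / 200) (hh : h ≠ 0) : |Qder2 b h u| ≤ 5328 * ρ₀ ^ 2 * ‖h‖ ^ 2 := by
  obtain ⟨hΘ1, hM1⟩ := norm_deriv_line_le_at (X := 0) (Y := b) (u : ℂ) hs hρ0 (by linarith) hh
  obtain ⟨hΘ2, hM2⟩ := norm_deriv_deriv_line_le_at (X := 0) (Y := b) (u : ℂ) hs hρ0 hρ hh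
  have hD : ‖lineD 0 b h u‖ ≤ ρ₀ := le_trans (norm_add_le _ _) hs
  have hsu : ‖(0 : 𝕄 N)‖ + ‖b‖ + ‖(u : ℂ)‖ * ‖h‖ ≤ ρ₀ := by
    rw [norm_zero, zero_add, zero_sub, norm_neg, norm_smul] at *; linarith
  have hM0 := norm_lineM_le (X := 0) (Y := b) (h := h) (t := u) (by linarith)
  have hM : ‖lineM 0 b h u‖ ≤ 3 * ρ₀ ^ 2 := by
    rw [norm_zero, zero_add] at hM0 hsu
    have h0 : 0 ≤ ‖b‖ + ‖(u : ℂ)‖ * ‖h‖ := by positivity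
    have h2 : (‖b‖ + ‖(u : ℂ)‖ * ‖h‖) ^ 2 ≤ ρ₀ ^ 2 := pow_le_pow_left₀ h0 hsu 2
    linarith
  have hh0 : 0 ≤ ‖h‖ := norm_nonneg h
  rw [Qder2]
  have t1 := abs_frobB_le (lineD 0 b h u) (deriv (deriv (lineΘ 0 b h)) u)
  have t2 := abs_frobB_le (-h) (deriv (lineΘ 0 b h) u)
  have t3 := abs_frobB_le (lineM 0 b h u) (deriv (deriv (lineM 0 b h)) u)
  have t4 := abs_frobB_le (deriv (lineM 0 b h) u) (deriv (lineM 0 b h) u)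
  have t5 := abs_frobB_le (deriv (deriv (lineM 0 b h)) u) (lineM 0 b h u)
  rw [norm_neg] at t2
  have b1 : ‖lineD 0 b h u‖ * ‖deriv (deriv (lineΘ 0 b h)) u‖ ≤ ρ₀ * (1632 * ρ₀ * ‖h‖ ^ 2) :=
    mul_le_mul hD hΘ2 (norm_nonneg _) hρ0.le
  have b2 : ‖h‖ * ‖deriv (lineΘ 0 b h) u‖ ≤ ‖h‖ * (408 * ρ₀ ^ 2 * ‖h‖) := mul_le_mul_of_nonneg_left hΘ1 hh0
  have b3 : ‖lineM 0 b h u‖ * ‖deriv (deriv (lineM 0 b h)) u‖ ≤ 3 * ρ₀ ^ 2 * (24 * ‖h‖ ^ 2) :=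
    mul_le_mul hM hM2 (norm_nonneg _) (by positivity)
  have b4 : ‖deriv (lineM 0 b h) u‖ * ‖deriv (lineM 0 b h) u‖ ≤ (12 * ρ₀ * ‖h‖) * (12 * ρ₀ * ‖h‖) :=
    mul_le_mul hM1 hM1 (norm_nonneg _) (by positivity)
  have b5 : ‖deriv (deriv (lineM 0 b h)) u‖ * ‖lineM 0 b h u‖ ≤ 24 * ‖h‖ ^ 2 * (3 * ρ₀ ^ 2) :=
    mul_le_mul hM2 hM (norm_nonneg _) (by positivity)
  have e : (5328 : ℝ) * ρ₀ ^ 2 * ‖h‖ ^ 2 = 2 * ((ρ₀ * (1632 * ρ₀ * ‖h‖ ^ 2) + ‖h‖ * (408 * ρ₀ ^ 2 * ‖h‖))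
      + ‖h‖ * (408 * ρ₀ ^ 2 * ‖h‖)) + ((3 * ρ₀ ^ 2 * (24 * ‖h‖ ^ 2) + 12 * ρ₀ * ‖h‖ * (12 * ρ₀ * ‖h‖))
      + (12 * ρ₀ * ‖h‖ * (12 * ρ₀ * ‖h‖) + 24 * ‖h‖ ^ 2 * (3 * ρ₀ ^ 2))) := by ring
  rw [e]
  refine (abs_add_le _ _).trans (add_le_add ?_ ?_)
  · rw [abs_mul, abs_two]
    refine mul_le_mul_of_nonneg_left ((abs_add_le _ _).trans (add_le_add ((abs_add_le _ _).trans (add_le_add ?_ ?_)) ?_))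
      two_pos.le
    · exact t1.trans b1
    · exact t2.trans b2
    · exact t2.trans b2
  · refine (abs_add_le _ _).trans (add_le_add ((abs_add_le _ _).trans (add_le_add ?_ ?_))
      ((abs_add_le _ _).trans (add_le_add ?_ ?_)))
    · exact t3.trans b3
    · exact t4.trans b4
    · exact t4.trans b4
    · exact t5.trans b5

/-! ## §3 `ψ(τ) = dF_B(τx)(x) = Q′(τ)` on `[0, 1]`, `ψ(0) = 0`, and `|dF_B(x)(x)| ≤ 5328ρ₀²|x|²` by the mean value inequality -/

/-- `F_B(ux) = Q(u)` for `|u| < 2` when `|x|, |B| < 1/1000`. [cite: Federbush1987PhaseCellIII, Lemma 1.3 (1.12) p. 295–296] -/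
theorem FLem_smul_eq_Qfun {B x : uN N} (hB : ‖B‖ < 1 / 1000) (hx : ‖x‖ < 1 / 1000) {u : ℝ} (hu : |u| < 2) :
    FLem B (u • x) = Qfun B.val x.val u := by
  have hle : ‖(0 : uN N) + u • x‖ + ‖B‖ ≤ 1 / 50 := by
    rw [zero_add, norm_smul, Real.norm_eq_abs]
    nlinarith [abs_nonneg u, norm_nonneg x]
  have e := FLem_line_eq 0 B x hle
  rw [zero_add, show -(0 : uN N).val = (0 : 𝕄 N) from by rw [show (0 : uN N).val = 0 from rfl, neg_zero]] at e
  rw [e, Qfun, frobB_self]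

/-- `dF_B(τx)(x) = Q′(τ)` for `|τ| ≤ 1`. [cite: Federbush1987PhaseCellIII, Lemma 1.3 (1.12) p. 295–296] -/
theorem fderiv_FLem_smul_apply_eq_Qder {B x : uN N} (hB : ‖B‖ < 1 / 1000) (hx : ‖x‖ < 1 / 1000) {τ : ℝ} (hτ : |τ| ≤ 1) :
    fderiv ℝ (FLem B) (τ • x) x = Qder B.val x.val τ := by
  have hτx : ‖τ • x‖ < 1 / 100 := by
    rw [norm_smul, Real.norm_eq_abs]; nlinarith [abs_nonneg τ, norm_nonneg x]
  have hline : HasDerivAt (fun u : ℝ => u • x) x τ := by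
    have := (hasDerivAt_id' τ).smul_const x; rwa [one_smul] at this
  have h5 : HasDerivAt (fun u : ℝ => FLem B (u • x)) (fderiv ℝ (FLem B) (τ • x) x) τ :=
    (differentiableAt_FLem hτx (by linarith)).hasFDerivAt.comp_hasDerivAt_of_eq τ hline rfl
  have hu : ‖(0 : 𝕄 N) - (τ : ℂ) • x.val‖ + ‖B.val‖ ≤ 1 / 5 := by
    rw [zero_sub, norm_neg, norm_smul, Complex.norm_real, Real.norm_eq_abs, ← uN.norm_def, ← uN.norm_def]
    nlinarith [abs_nonneg τ, norm_nonneg x]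
  have hev : (fun u : ℝ => FLem B (u • x)) =ᶠ[𝓝 τ] Qfun B.val x.val := by
    filter_upwards [Metric.ball_mem_nhds τ one_pos] with u hu'
    rw [Metric.mem_ball, Real.dist_eq] at hu'
    exact FLem_smul_eq_Qfun hB hx (by have := abs_sub_abs_le_abs_sub u τ; linarith)
  have h6 : HasDerivAt (fun u : ℝ => FLem B (u • x)) (Qder B.val x.val τ) τ :=
    (hasDerivAt_Qfun hu).congr_of_eventuallyEq hev
  exact h5.unique h6

/-- **`|dF_B(x)(x)| ≤ (5328/250000)|x|²`** for `|x|, |B| < 1/1000`: `dF_B(0)(x) = 0` (`fderiv_FLem_zero_of_small`) and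
`|Q′(1) − Q′(0)| ≤ sup_{[0,1]} |Q″| ≤ 5328 ρ₀²|x|²`, `ρ₀ = 1/500` (Mathlib `norm_image_sub_le_of_norm_deriv_le_segment'`).
[cite: Federbush1987PhaseCellIII, Lemma 1.3 (1.12) p. 295–296] -/
theorem abs_fderiv_FLem_self_le {B x : uN N} (hB : ‖B‖ < 1 / 1000) (hx : ‖x‖ < 1 / 1000) :
    |fderiv ℝ (FLem B) x x| ≤ 5328 * (1 / 500) ^ 2 * ‖x‖ ^ 2 := by
  rcases eq_or_ne x 0 with hx0 | hx0
  · rw [hx0, map_zero, abs_zero, norm_zero]; norm_num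
  have hh : x.val ≠ 0 := fun h0 => hx0 (by
    have : ‖x‖ = 0 := by rw [uN.norm_def, h0, norm_zero]
    exact norm_eq_zero.mp this)
  have hxv : ‖x.val‖ = ‖x‖ := (uN.norm_def x).symm
  -- `ψ(1) = Q′(1)`, `ψ(0) = Q′(0) = 0`
  have h1 : fderiv ℝ (FLem B) x x = Qder B.val x.val 1 := by
    have := fderiv_FLem_smul_apply_eq_Qder hB hx (τ := 1) (by rw [abs_one]); rwa [one_smul] at this
  have h0 : Qder B.val x.val 0 = 0 := by
    have := fderiv_FLem_smul_apply_eq_Qder hB hx (τ := 0) (by rw [abs_zero]; exact zero_le_one)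
    rw [zero_smul, fderiv_FLem_zero_of_small (by linarith), _root_.zero_apply] at this
    exact this.symm
  -- mean value inequality for `Q′` on `[0, 1]`
  have hs : ∀ u ∈ Icc (0 : ℝ) 1, ‖(0 : 𝕄 N) - (u : ℂ) • x.val‖ + ‖B.val‖ ≤ 1 / 500 := by
    intro u hu
    rw [zero_sub, norm_neg, norm_smul, Complex.norm_real, Real.norm_of_nonneg hu.1, hxv, ← uN.norm_def]
    nlinarith [hu.2, norm_nonneg x]
  have hder : ∀ u ∈ Icc (0 : ℝ) 1, HasDerivWithinAt (Qder B.val x.val) (Qder2 B.val x.val u) (Icc 0 1) u :=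
    fun u hu => (hasDerivAt_Qder (by linarith [hs u hu])).hasDerivWithinAt
  have hbound : ∀ u ∈ Ico (0 : ℝ) 1, ‖Qder2 B.val x.val u‖ ≤ 5328 * (1 / 500) ^ 2 * ‖x‖ ^ 2 := by
    intro u hu
    rw [Real.norm_eq_abs, ← hxv]
    exact abs_Qder2_le (hs u (Ico_subset_Icc_self hu)) (by norm_num) (by norm_num) hh
  have hmv := norm_image_sub_le_of_norm_deriv_le_segment' hder hbound 1 (right_mem_Icc.mpr zero_le_one)
  rw [h0, sub_zero, sub_zero, mul_one, Real.norm_eq_abs] at hmv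
  rw [h1]
  exact hmv

/-! ## §4 Lemma 1.3 for `G = U(N)` -/

/-- **Row F3.Lem1.3 — PROVED for the model instance `G = U(N)`, every `N`** (`ρ = 1/1000`): if `e^x` is a pure average of
`e^{A_1}, …, e^{A_n}`, `|x|, |A_i| < 1/1000`, then `x = 0 ⇔ ΣA_i = 0`.  `⇒`: `UN.sum_eq_zero_of_isPureAverage_one` (first variation).
`⇐`: the first-order condition in the direction `V = x` reads `2⟨ΣA_i, x⟩ − 2n|x|² = Σ_i dF_{A_i}(x)(x)`; with `ΣA_i = 0` and
`|dF_{A_i}(x)(x)| ≤ 0.0214|x|²` (`abs_fderiv_FLem_self_le`: `dF_{A_i}(0) = 0` and the second-order bound along the segment) this forces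
`x = 0` — i.e. the pure average is the unique critical point in the small ball. [cite: Federbush1987PhaseCellIII, Lemma 1.3 (1.12) p. 295–296] -/
theorem lemma13_UN : Lemma13 (expUN (N := N)) := by
  refine ⟨1 / 1000, by norm_num, fun n hn A x hA hx hmin => ⟨fun hx0 => ?_, fun hsum => ?_⟩⟩
  · subst hx0
    rw [expUN_zero] at hmin
    exact sum_eq_zero_of_isPureAverage_one (fun i => by linarith [hA i]) hmin
  · have hfoc := first_order_condition (fun i => by linarith [hA i]) (by linarith) hmin x
    have hψ : ∀ i, |fderiv ℝ (FLem (A i)) x x| ≤ 5328 * (1 / 500) ^ 2 * ‖x‖ ^ 2 :=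
      fun i => abs_fderiv_FLem_self_le (hA i) hx
    -- `Σ_i 2⟨A_i − x, x⟩ = 2⟨ΣA_i, x⟩ − 2n|x|² = −2n|x|²`
    have hlin : ∑ i, 2 * inner ℝ (A i - x) x = -(2 * n * ‖x‖ ^ 2) := by
      have : ∀ i, 2 * inner ℝ (A i - x) x = 2 * inner ℝ (A i) x - 2 * ‖x‖ ^ 2 := fun i => by
        rw [inner_sub_left, real_inner_self_eq_norm_sq]; ring
      simp_rw [this, Finset.sum_sub_distrib, ← Finset.mul_sum, ← sum_inner, hsum, inner_zero_left, mul_zero, zero_sub,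
        Finset.sum_const, Finset.card_univ, Fintype.card_fin, nsmul_eq_mul]
      ring
    have hS : ∑ i, fderiv ℝ (FLem (A i)) x x = -(2 * n * ‖x‖ ^ 2) := by
      have e : ∑ i, fderiv ℝ (FLem (A i)) x x
          = ∑ i, 2 * inner ℝ (A i - x) x - ∑ i, (2 * inner ℝ (A i - x) x - fderiv ℝ (FLem (A i)) x x) := by
        rw [← Finset.sum_sub_distrib]; exact Finset.sum_congr rfl fun i _ => by ring
      rw [e, hfoc, sub_zero, hlin]
    have habs : |∑ i, fderiv ℝ (FLem (A i)) x x| ≤ ∑ i, |fderiv ℝ (FLem (A i)) x x| := Finset.abs_sum_le_sum_abs _ _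
    have hle : ∑ i, |fderiv ℝ (FLem (A i)) x x| ≤ ∑ _i : Fin n, 5328 * (1 / 500) ^ 2 * ‖x‖ ^ 2 :=
      Finset.sum_le_sum fun i _ => hψ i
    rw [Finset.sum_const, Finset.card_univ, Fintype.card_fin, nsmul_eq_mul] at hle
    rw [hS, abs_neg, abs_of_nonneg (by positivity)] at habs
    have hn1 : (1 : ℝ) ≤ n := by exact_mod_cast hn
    have hx2 : ‖x‖ ^ 2 ≤ 0 := by nlinarith [sq_nonneg ‖x‖]
    have : ‖x‖ = 0 := by nlinarith [norm_nonneg x]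
    exact norm_eq_zero.mp this

end UN

end

end Literature.MathematicalPhysics.QuantumFieldTheory.Federbush1986
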